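import Summits.HodgeConjecture.HodgeConjecture.Theorems.F0P3cStCharTSWeylHypWIFJacLocal   -- ★ p851645 «(WIF) ⟸ JAC-LOC» (the socket `hJacLoc` this file re-reads); brings ★ p849989, ★ S9a CartanFields (`Gqs`)
import HarnessLib

/-!
# F0 · P3c · line LH6 «StCharTS» — «ADAPTER-M★»: the JAC-LOC socket of ★ p851645 (split torus `M`, Weyl-element clause) READ IN THE CARTAN SOCKET SHAPE of ★ p851803
# (`T = Z(γ₀)`, `W`-free clause, abstract conjugation map `Φ`, given torus measure) — on the matrix carrier and on `Gqs L v` (Rogawski 1990 §12.5 p. 182; Harish-Chandra 1970 L. 20 ∕ L. 22)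

Cell `pub/hodgecm-mathlib`, crux H413 = `stmt-HodgeConjecture-24833` (lane `--supports … --as helper`); seat F0P3-p02 (g21); brick «ADAPTER-M» cut by the ELL-TOR★ holder
F0P3a-p05 (g22) 2026-09-02T15:14:55Z («the ONLY `M`-specific piece left: ★ p851645's `hJacLoc` (carrier `↥(unitaryGroupOfForm …)`, `T := (cmBorelTriple L 3 v).M`, `w`-clause
`t′ ≠ w t w⁻¹`) ⟹ (E1b)'s `hJacLoc` at `T i := M` read as `Z(m₀)` on `Gqs L v` (`W`-free clause `∀ n ∉ T, t′ ≠ n t n⁻¹`)»).  THEOREMS ONLY; ★-only imports.  HONEST LABEL: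
HC_CM is proved only modulo the 7 printed citations (2 remaining: hLiu418 = `stmt-HodgeConjecture-24832`, h413 = `stmt-HodgeConjecture-24833`) until rung 0 closes;
count-neutral; pure plumbing — it moves the JAC-LOC road's output (★ p851645's socket, paid by (J0)–(J7)) into the `hJac i` slot of (E4) `weylIntegrationFormula_of_pins_of_tubeJacobians`
at the split Cartan `T i = M`, and proves nothing about the Jacobian itself.

THE TWO SOCKETS.  ★ p851645 `integral_mul_eq_integral_classOrbitalIntegral_density_of_tubeJacobian_local` asks, for EVERY Haar measure `tT` of `M` with inversion symmetry and
`tT (compactCore M) = 1`: every regular `t₀ ∈ M` has an open `U ∋ t₀` and a measurable `A₀ ⊆ G ⧸ M` of quotient measure `∈ (0, ∞)` such that for all measurable regular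
`V ⊆ U` with **`∀ t t′ ∈ V, t′ ≠ w t w⁻¹`** (`w` the Weyl representative `Φ₃`) the tube `{x t x⁻¹ | x̄ ∈ A₀, t ∈ V}` has `ν`-measure `μ₀(A₀) · ∫⁻_V D dtT` (Borel σ-algebra on
`G ⧸ M`).  ★ p851803 `lintegral_cartanSet_eq_of_tubeJacobian_local` asks the same at a Cartan `T = Z(γ₀)` for ONE given torus measure `tm`, an abstract conjugation map
`Φ : (G ⧸ T) × T → G` (`Φ(x̄, t) = x t x⁻¹`), any Borel structure on `G ⧸ T`, with the **`W`-FREE clause `∀ n ∉ T, ∀ t t′ ∈ V, t′ ≠ n t n⁻¹`** and the tube written `Φ '' (A₀ ×ˢ V)`.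
Since `w ∉ M` (★ `weyl_not_mem_torusU`), the `W`-free clause implies the `w`-clause, so p851645's socket at `T = M` IMPLIES p851803's: that is all this file says.
* `tubeJacobianLocal_cartan_of_cmTorus` — matrix carrier, `T` any subgroup with `T = M` (variable `T`, so that dependent data `tm`, `D`, `Φ`, the σ-algebra on `G ⧸ T` are the
  consumer's own), weight `D` on `T` identified with the socket's weight `DM` on `M` pointwise (`hDD`);
* `tubeJacobianLocal_cartan_Gqs_of_cmTorus` — the same read on the organ carrier `Gqs L v` in the binder shape of ★ p851803 ∕ (E4) (the matrix-carrier instances are the organ's,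
  re-read by `letI` as in ★ S9a `nonEllCartanAE_of_split`).

## References
* [Rogawski1990] J. D. Rogawski, *Automorphic Representations of Unitary Groups in Three Variables*, Ann. of Math. Stud. 123 (1990), §12.5 p. 182, §3.6 p. 29.
* [HarishChandra1970] Harish-Chandra (notes by G. van Dijk), LNM 162 (1970), Lemma 20, Lemma 22.
-/

set_option autoImplicit false
-- the mandated namespace has the single-problem summit's repeated segment (`HodgeConjecture.HodgeConjecture`)
set_option linter.dupNamespace false

noncomputable section

open MeasureTheory Measure Set Filter Topology Function NumberField IsDedekindDomain Matrix
open Literature.MeasureTheory.Group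
open Literature.NumberTheory.Automorphic Literature.NumberTheory.Automorphic.UnitaryGroup Literature.NumberTheory.Rogawski1990
open Summit.HodgeConjecture.HodgeConjecture.Cruxes.H413.F0P3cStCharTSWeylHypMeasure
open Summit.HodgeConjecture.HodgeConjecture.Cruxes.H413.F0P3cStCharTSWeylHypCM
open Summit.HodgeConjecture.HodgeConjecture.Cruxes.H413.F0P3cStCharTSWeylHypTorsor
open scoped ENNReal NNReal MatrixGroups Pointwise

namespace Summit.HodgeConjecture.HodgeConjecture.Cruxes.H413.F0P3cStCharTSWeylHypSocketAdapter

variable (L : Type) [Field L] [NumberField L] [IsCMField L] (v : HeightOneSpectrum (𝓞 ↥(maximalRealSubfield L)))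

/-! ## §1 On the matrix carrier `U(Φ₃)(L⁺_v)` -/

set_option maxHeartbeats 800000 in
set_option synthInstance.maxHeartbeats 400000 in
-- long socket statements (as in ★ p849989 ∕ ★ p851645)
/-- **«ADAPTER-M» (matrix carrier).**  `T` a subgroup of `U(Φ₃)(L⁺_v)` EQUAL to the split torus `M` (`hTM`), closed (`hTcl`), with any Borel structure on `G ⧸ T`, a conjugation
map `Φ` (`hΦ`), a Haar measure `tm` of `T` with inversion symmetry and `tm (compactCore T) = 1`, `w` the Weyl representative (`hw`), and a weight `D` on `T` agreeing with the
socket's weight `DM` on `M` (`hDD`).  IF ★ p851645's socket `hJacLoc` holds (verbatim: `∀ tT` Haar inversion-symmetric of `compactCore`-mass `1`, `w`-clause, Borel `G ⧸ M`), THEN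
★ p851803's socket holds at `T`: every regular `t₀ ∈ T` has an open `U ∋ t₀` and a measurable `A₀ ⊆ G ⧸ T` with `μ₀(A₀) ∈ (0, ∞)` (`μ₀ = quotientMeasure T tm hTcl ν`) such that
for all measurable regular `W`-free `V ⊆ U`, `ν (Φ '' (A₀ ×ˢ V)) = μ₀(A₀) · ∫⁻_V D dtm`.  Proof: instantiate `tT := tm`; the `W`-free clause at `n := w ∉ M`
(★ `weyl_not_mem_torusU`) is the `w`-clause; `Φ '' (A₀ ×ˢ V)` is the socket's tube by `hΦ`. [cite: Rogawski1990, §12.5 p. 182; §3.6 p. 29] [cite: HarishChandra1970, Lemma 20; Lemma 22] -/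
theorem tubeJacobianLocal_cartan_of_cmTorus
    [MeasurableSpace ↥(unitaryGroupOfForm (conjLocal L (IsCMField.complexConj L) v) (cmLocalForm L 3 v))] [BorelSpace ↥(unitaryGroupOfForm (conjLocal L (IsCMField.complexConj L) v) (cmLocalForm L 3 v))] [LocallyCompactSpace ↥(unitaryGroupOfForm (conjLocal L (IsCMField.complexConj L) v) (cmLocalForm L 3 v))] [SecondCountableTopology ↥(unitaryGroupOfForm (conjLocal L (IsCMField.complexConj L) v) (cmLocalForm L 3 v))] [T2Space ↥(unitaryGroupOfForm (conjLocal L (IsCMField.complexConj L) v) (cmLocalForm L 3 v))]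
    (ν : Measure ↥(unitaryGroupOfForm (conjLocal L (IsCMField.complexConj L) v) (cmLocalForm L 3 v))) [ν.IsHaarMeasure] [ν.IsMulRightInvariant]
    {T : Subgroup ↥(unitaryGroupOfForm (conjLocal L (IsCMField.complexConj L) v) (cmLocalForm L 3 v))} (hTM : T = (cmBorelTriple L 3 v).M) (hTcl : IsClosed (T : Set ↥(unitaryGroupOfForm (conjLocal L (IsCMField.complexConj L) v) (cmLocalForm L 3 v))))
    [MeasurableSpace (↥(unitaryGroupOfForm (conjLocal L (IsCMField.complexConj L) v) (cmLocalForm L 3 v)) ⧸ T)] [BorelSpace (↥(unitaryGroupOfForm (conjLocal L (IsCMField.complexConj L) v) (cmLocalForm L 3 v)) ⧸ T)]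
    (Φ : (↥(unitaryGroupOfForm (conjLocal L (IsCMField.complexConj L) v) (cmLocalForm L 3 v)) ⧸ T) × ↥T → ↥(unitaryGroupOfForm (conjLocal L (IsCMField.complexConj L) v) (cmLocalForm L 3 v))) (hΦ : ∀ (x : ↥(unitaryGroupOfForm (conjLocal L (IsCMField.complexConj L) v) (cmLocalForm L 3 v))) (t : ↥T), Φ (QuotientGroup.mk x, t) = x * t * x⁻¹)
    (tm : Measure ↥T) [tm.IsHaarMeasure] [tm.IsInvInvariant] (htm : tm (compactCore ↥T) = 1)
    (w : ↥(unitaryGroupOfForm (conjLocal L (IsCMField.complexConj L) v) (cmLocalForm L 3 v))) (hw : Units.val (w : GL (Fin 3) (LocalRing L v)) = cmLocalForm L 3 v)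
    (DM : ↥(cmBorelTriple L 3 v).M → ℝ≥0) (D : ↥T → ℝ≥0) (hDD : ∀ (t : ↥T) (t' : ↥(cmBorelTriple L 3 v).M), (t : ↥(unitaryGroupOfForm (conjLocal L (IsCMField.complexConj L) v) (cmLocalForm L 3 v))) = (t' : ↥(unitaryGroupOfForm (conjLocal L (IsCMField.complexConj L) v) (cmLocalForm L 3 v))) → D t = DM t')
    (hJacLoc : letI : MeasurableSpace (↥(unitaryGroupOfForm (conjLocal L (IsCMField.complexConj L) v) (cmLocalForm L 3 v)) ⧸ (cmBorelTriple L 3 v).M) := borel _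
      haveI : BorelSpace (↥(unitaryGroupOfForm (conjLocal L (IsCMField.complexConj L) v) (cmLocalForm L 3 v)) ⧸ (cmBorelTriple L 3 v).M) := ⟨rfl⟩
      ∀ (tT : Measure ↥(cmBorelTriple L 3 v).M) (_ : tT.IsHaarMeasure) (_ : tT.IsInvInvariant), tT (compactCore ↥(cmBorelTriple L 3 v).M) = 1 →
        ∀ t₀ : ↥(cmBorelTriple L 3 v).M, IsRegularElt (((t₀ : ↥(unitaryGroupOfForm (conjLocal L (IsCMField.complexConj L) v) (cmLocalForm L 3 v)))) : GL (Fin 3) (LocalRing L v)) →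
        ∃ U : Set ↥(cmBorelTriple L 3 v).M, IsOpen U ∧ t₀ ∈ U ∧
        ∃ A₀ : Set (↥(unitaryGroupOfForm (conjLocal L (IsCMField.complexConj L) v) (cmLocalForm L 3 v)) ⧸ (cmBorelTriple L 3 v).M), MeasurableSet A₀ ∧
          quotientMeasure (cmBorelTriple L 3 v).M tT (isClosed_cmBorelTriple_M L v) ν A₀ ≠ 0 ∧ quotientMeasure (cmBorelTriple L 3 v).M tT (isClosed_cmBorelTriple_M L v) ν A₀ ≠ ∞ ∧
          ∀ V : Set ↥(cmBorelTriple L 3 v).M, MeasurableSet V → V ⊆ U → (∀ t ∈ V, IsRegularElt (((t : ↥(unitaryGroupOfForm (conjLocal L (IsCMField.complexConj L) v) (cmLocalForm L 3 v)))) : GL (Fin 3) (LocalRing L v))) →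
            (∀ t ∈ V, ∀ t' ∈ V, ((t' : ↥(cmBorelTriple L 3 v).M) : ↥(unitaryGroupOfForm (conjLocal L (IsCMField.complexConj L) v) (cmLocalForm L 3 v))) ≠ w * t * w⁻¹) →
              ν {y : ↥(unitaryGroupOfForm (conjLocal L (IsCMField.complexConj L) v) (cmLocalForm L 3 v)) | ∃ (x : ↥(unitaryGroupOfForm (conjLocal L (IsCMField.complexConj L) v) (cmLocalForm L 3 v))) (t : ↥(cmBorelTriple L 3 v).M), (QuotientGroup.mk x : ↥(unitaryGroupOfForm (conjLocal L (IsCMField.complexConj L) v) (cmLocalForm L 3 v)) ⧸ (cmBorelTriple L 3 v).M) ∈ A₀ ∧ t ∈ V ∧ y = x * t * x⁻¹} =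
                quotientMeasure (cmBorelTriple L 3 v).M tT (isClosed_cmBorelTriple_M L v) ν A₀ * ∫⁻ t in V, (DM t : ℝ≥0∞) ∂tT) :
    ∀ t₀ : ↥T, IsRegularElt (((t₀ : ↥(unitaryGroupOfForm (conjLocal L (IsCMField.complexConj L) v) (cmLocalForm L 3 v)))) : GL (Fin 3) (LocalRing L v)) →
      ∃ U : Set ↥T, IsOpen U ∧ t₀ ∈ U ∧
        ∃ A₀ : Set (↥(unitaryGroupOfForm (conjLocal L (IsCMField.complexConj L) v) (cmLocalForm L 3 v)) ⧸ T), MeasurableSet A₀ ∧ (quotientMeasure T tm hTcl ν) A₀ ≠ 0 ∧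
          (quotientMeasure T tm hTcl ν) A₀ ≠ ∞ ∧
          ∀ V : Set ↥T, MeasurableSet V → V ⊆ U → (∀ t ∈ V, IsRegularElt (((t : ↥(unitaryGroupOfForm (conjLocal L (IsCMField.complexConj L) v) (cmLocalForm L 3 v)))) : GL (Fin 3) (LocalRing L v))) →
            (∀ n : ↥(unitaryGroupOfForm (conjLocal L (IsCMField.complexConj L) v) (cmLocalForm L 3 v)), n ∉ T → ∀ t ∈ V, ∀ t' ∈ V, ((t' : ↥T) : ↥(unitaryGroupOfForm (conjLocal L (IsCMField.complexConj L) v) (cmLocalForm L 3 v))) ≠ n * t * n⁻¹) →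
              ν (Φ '' (A₀ ×ˢ V)) = (quotientMeasure T tm hTcl ν) A₀ * ∫⁻ t in V, (D t : ℝ≥0∞) ∂tm := by
  subst hTM
  have hσ : ‹MeasurableSpace (↥(unitaryGroupOfForm (conjLocal L (IsCMField.complexConj L) v) (cmLocalForm L 3 v)) ⧸ (cmBorelTriple L 3 v).M)› = borel _ := BorelSpace.measurable_eq
  subst hσ
  have hDfun : D = DM := funext fun t => hDD t t rfl
  subst hDfun
  -- `w ∉ M`
  haveI : Nontrivial (LocalRing L v) := UnitaryGroup.nontrivial_localRing L v
  have hwM : w ∉ (cmBorelTriple L 3 v).M := weyl_not_mem_torusU (σ := conjLocal L (IsCMField.complexConj L) v) (cmLocalForm_eq_over L 3 v) hw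
  intro t₀ ht₀
  obtain ⟨U, hUo, ht₀U, A₀, hA₀m, hA₀0, hA₀top, hJ⟩ := hJacLoc tm ‹_› ‹_› htm t₀ ht₀
  refine ⟨U, hUo, ht₀U, A₀, hA₀m, hA₀0, hA₀top, fun V hVm hVU hVreg hVfree => ?_⟩
  have hVw : ∀ t ∈ V, ∀ t' ∈ V, ((t' : ↥(cmBorelTriple L 3 v).M) : ↥(unitaryGroupOfForm (conjLocal L (IsCMField.complexConj L) v) (cmLocalForm L 3 v))) ≠ w * t * w⁻¹ := fun t ht t' ht' => hVfree w hwM t ht t' ht'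
  have htube : Φ '' (A₀ ×ˢ V) = {y : ↥(unitaryGroupOfForm (conjLocal L (IsCMField.complexConj L) v) (cmLocalForm L 3 v)) | ∃ (x : ↥(unitaryGroupOfForm (conjLocal L (IsCMField.complexConj L) v) (cmLocalForm L 3 v))) (t : ↥(cmBorelTriple L 3 v).M), (QuotientGroup.mk x : ↥(unitaryGroupOfForm (conjLocal L (IsCMField.complexConj L) v) (cmLocalForm L 3 v)) ⧸ (cmBorelTriple L 3 v).M) ∈ A₀ ∧ t ∈ V ∧ y = x * t * x⁻¹} := by
    ext y
    constructor
    · rintro ⟨⟨q, t⟩, ⟨hq, ht⟩, rfl⟩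
      obtain ⟨x, rfl⟩ := QuotientGroup.mk_surjective q
      exact ⟨x, t, hq, ht, hΦ x t⟩
    · rintro ⟨x, t, hx, ht, rfl⟩
      exact ⟨(QuotientGroup.mk x, t), ⟨hx, ht⟩, hΦ x t⟩
  rw [htube]
  exact hJ V hVm hVU hVreg hVw

/-! ## §2 On the organ carrier `Gqs L v` (the binder shape of ★ p851803 ∕ (E4)) -/

set_option maxHeartbeats 1600000 in
set_option synthInstance.maxHeartbeats 400000 in
-- long socket statements; the matrix-carrier instances inside `hJacLoc` are the organ's, re-read by `letI` (★ S9a `nonEllCartanAE_of_split`)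
/-- **«ADAPTER-M» (organ carrier `Gqs L v`).**  The same implication with every binder on `Gqs L v` exactly as ★ p851803 `lintegral_cartanSet_eq_of_tubeJacobian_local` ∕ (E4)
read them (`T : Subgroup (Gqs L v)` with `T = M`, closed; Borel `Gqs L v ⧸ T`; `Φ`, `hΦ`; `ν`; `tm` Haar inversion-symmetric with `tm (compactCore T) = 1`; weight `D` on `T`
agreeing with `DM` on `M`), the hypothesis being ★ p851645's socket VERBATIM with its matrix-carrier σ-algebra read off the organ's (`letI`).  Use: the `hJac i` slot of (E4)
`weylIntegrationFormula_of_pins_of_tubeJacobians` at the split Cartan `T i = M = Z(m₀)` (★ `exists_isRegularElt_centralizer_eq_cmTorus`) is this conclusion with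
`hTcl := isClosed_cartan (hT i)`. [cite: Rogawski1990, §12.5 p. 182; §3.6 p. 29] [cite: HarishChandra1970, Lemma 20; Lemma 22] -/
theorem tubeJacobianLocal_cartan_Gqs_of_cmTorus
    [MeasurableSpace (Gqs L v)] [BorelSpace (Gqs L v)] [LocallyCompactSpace (Gqs L v)] [SecondCountableTopology (Gqs L v)] [T2Space (Gqs L v)]
    (ν : Measure (Gqs L v)) [ν.IsHaarMeasure] [ν.IsMulRightInvariant]
    {T : Subgroup (Gqs L v)} (hTM : T = (cmBorelTriple L 3 v).M) (hTcl : IsClosed (T : Set (Gqs L v)))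
    [MeasurableSpace (Gqs L v ⧸ T)] [BorelSpace (Gqs L v ⧸ T)]
    (Φ : (Gqs L v ⧸ T) × ↥T → Gqs L v) (hΦ : ∀ (x : Gqs L v) (t : ↥T), Φ (QuotientGroup.mk x, t) = x * t * x⁻¹)
    (tm : Measure ↥T) [tm.IsHaarMeasure] [tm.IsInvInvariant] (htm : tm (compactCore ↥T) = 1)
    (w : ↥(unitaryGroupOfForm (conjLocal L (IsCMField.complexConj L) v) (cmLocalForm L 3 v))) (hw : Units.val (w : GL (Fin 3) (LocalRing L v)) = cmLocalForm L 3 v)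
    (DM : ↥(cmBorelTriple L 3 v).M → ℝ≥0) (D : ↥T → ℝ≥0) (hDD : ∀ (t : ↥T) (t' : ↥(cmBorelTriple L 3 v).M), (t : Gqs L v) = (t' : ↥(unitaryGroupOfForm (conjLocal L (IsCMField.complexConj L) v) (cmLocalForm L 3 v))) → D t = DM t')
    (hJacLoc : by
      -- the matrix-carrier instances ARE the organ's (`Gqs L v` unfolds to the carrier, not at instance transparency): re-read them, then state ★ p851645's socket verbatim
      letI : MeasurableSpace ↥(unitaryGroupOfForm (conjLocal L (IsCMField.complexConj L) v) (cmLocalForm L 3 v)) := ‹MeasurableSpace (Gqs L v)›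
      haveI : BorelSpace ↥(unitaryGroupOfForm (conjLocal L (IsCMField.complexConj L) v) (cmLocalForm L 3 v)) := ⟨BorelSpace.measurable_eq (α := Gqs L v)⟩
      haveI : LocallyCompactSpace ↥(unitaryGroupOfForm (conjLocal L (IsCMField.complexConj L) v) (cmLocalForm L 3 v)) := ‹LocallyCompactSpace (Gqs L v)›
      haveI : SecondCountableTopology ↥(unitaryGroupOfForm (conjLocal L (IsCMField.complexConj L) v) (cmLocalForm L 3 v)) := ‹SecondCountableTopology (Gqs L v)›
      haveI : T2Space ↥(unitaryGroupOfForm (conjLocal L (IsCMField.complexConj L) v) (cmLocalForm L 3 v)) := ‹T2Space (Gqs L v)›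
      haveI : Measure.IsHaarMeasure (G := ↥(unitaryGroupOfForm (conjLocal L (IsCMField.complexConj L) v) (cmLocalForm L 3 v))) ν := ‹ν.IsHaarMeasure›
      haveI : Measure.IsMulRightInvariant (G := ↥(unitaryGroupOfForm (conjLocal L (IsCMField.complexConj L) v) (cmLocalForm L 3 v))) ν := ‹ν.IsMulRightInvariant›
      exact (letI : MeasurableSpace (↥(unitaryGroupOfForm (conjLocal L (IsCMField.complexConj L) v) (cmLocalForm L 3 v)) ⧸ (cmBorelTriple L 3 v).M) := borel _
      haveI : BorelSpace (↥(unitaryGroupOfForm (conjLocal L (IsCMField.complexConj L) v) (cmLocalForm L 3 v)) ⧸ (cmBorelTriple L 3 v).M) := ⟨rfl⟩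
      ∀ (tT : Measure ↥(cmBorelTriple L 3 v).M) (_ : tT.IsHaarMeasure) (_ : tT.IsInvInvariant), tT (compactCore ↥(cmBorelTriple L 3 v).M) = 1 →
        ∀ t₀ : ↥(cmBorelTriple L 3 v).M, IsRegularElt (((t₀ : ↥(unitaryGroupOfForm (conjLocal L (IsCMField.complexConj L) v) (cmLocalForm L 3 v)))) : GL (Fin 3) (LocalRing L v)) →
        ∃ U : Set ↥(cmBorelTriple L 3 v).M, IsOpen U ∧ t₀ ∈ U ∧
        ∃ A₀ : Set (↥(unitaryGroupOfForm (conjLocal L (IsCMField.complexConj L) v) (cmLocalForm L 3 v)) ⧸ (cmBorelTriple L 3 v).M), MeasurableSet A₀ ∧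
          quotientMeasure (cmBorelTriple L 3 v).M tT (isClosed_cmBorelTriple_M L v) ν A₀ ≠ 0 ∧ quotientMeasure (cmBorelTriple L 3 v).M tT (isClosed_cmBorelTriple_M L v) ν A₀ ≠ ∞ ∧
          ∀ V : Set ↥(cmBorelTriple L 3 v).M, MeasurableSet V → V ⊆ U → (∀ t ∈ V, IsRegularElt (((t : ↥(unitaryGroupOfForm (conjLocal L (IsCMField.complexConj L) v) (cmLocalForm L 3 v)))) : GL (Fin 3) (LocalRing L v))) →
            (∀ t ∈ V, ∀ t' ∈ V, ((t' : ↥(cmBorelTriple L 3 v).M) : ↥(unitaryGroupOfForm (conjLocal L (IsCMField.complexConj L) v) (cmLocalForm L 3 v))) ≠ w * t * w⁻¹) →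
              ν {y : ↥(unitaryGroupOfForm (conjLocal L (IsCMField.complexConj L) v) (cmLocalForm L 3 v)) | ∃ (x : ↥(unitaryGroupOfForm (conjLocal L (IsCMField.complexConj L) v) (cmLocalForm L 3 v))) (t : ↥(cmBorelTriple L 3 v).M), (QuotientGroup.mk x : ↥(unitaryGroupOfForm (conjLocal L (IsCMField.complexConj L) v) (cmLocalForm L 3 v)) ⧸ (cmBorelTriple L 3 v).M) ∈ A₀ ∧ t ∈ V ∧ y = x * t * x⁻¹} =
                quotientMeasure (cmBorelTriple L 3 v).M tT (isClosed_cmBorelTriple_M L v) ν A₀ * ∫⁻ t in V, (DM t : ℝ≥0∞) ∂tT)) :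
    ∀ t₀ : ↥T, IsRegularElt (((t₀ : Gqs L v)).val : GL (Fin 3) (LocalRing L v)) →
      ∃ U : Set ↥T, IsOpen U ∧ t₀ ∈ U ∧
        ∃ A₀ : Set (Gqs L v ⧸ T), MeasurableSet A₀ ∧ (quotientMeasure T tm hTcl ν) A₀ ≠ 0 ∧
          (quotientMeasure T tm hTcl ν) A₀ ≠ ∞ ∧
          ∀ V : Set ↥T, MeasurableSet V → V ⊆ U → (∀ t ∈ V, IsRegularElt (((t : Gqs L v)).val : GL (Fin 3) (LocalRing L v))) →
            (∀ n : Gqs L v, n ∉ T → ∀ t ∈ V, ∀ t' ∈ V, ((t' : ↥T) : Gqs L v) ≠ n * t * n⁻¹) →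
              ν (Φ '' (A₀ ×ˢ V)) = (quotientMeasure T tm hTcl ν) A₀ * ∫⁻ t in V, (D t : ℝ≥0∞) ∂tm := by
  letI hmsU : MeasurableSpace ↥(unitaryGroupOfForm (conjLocal L (IsCMField.complexConj L) v) (cmLocalForm L 3 v)) := ‹MeasurableSpace (Gqs L v)›
  haveI hbU : BorelSpace ↥(unitaryGroupOfForm (conjLocal L (IsCMField.complexConj L) v) (cmLocalForm L 3 v)) := ⟨BorelSpace.measurable_eq (α := Gqs L v)⟩
  haveI hlcU : LocallyCompactSpace ↥(unitaryGroupOfForm (conjLocal L (IsCMField.complexConj L) v) (cmLocalForm L 3 v)) := ‹LocallyCompactSpace (Gqs L v)›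
  haveI hscU : SecondCountableTopology ↥(unitaryGroupOfForm (conjLocal L (IsCMField.complexConj L) v) (cmLocalForm L 3 v)) := ‹SecondCountableTopology (Gqs L v)›
  haveI ht2U : T2Space ↥(unitaryGroupOfForm (conjLocal L (IsCMField.complexConj L) v) (cmLocalForm L 3 v)) := ‹T2Space (Gqs L v)›
  haveI hHaarU : Measure.IsHaarMeasure (G := ↥(unitaryGroupOfForm (conjLocal L (IsCMField.complexConj L) v) (cmLocalForm L 3 v))) ν := ‹ν.IsHaarMeasure›
  haveI hRinvU : Measure.IsMulRightInvariant (G := ↥(unitaryGroupOfForm (conjLocal L (IsCMField.complexConj L) v) (cmLocalForm L 3 v))) ν := ‹ν.IsMulRightInvariant›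
  letI hmsQ : MeasurableSpace (↥(unitaryGroupOfForm (conjLocal L (IsCMField.complexConj L) v) (cmLocalForm L 3 v)) ⧸ T) := ‹MeasurableSpace (Gqs L v ⧸ T)›
  haveI hbQ : BorelSpace (↥(unitaryGroupOfForm (conjLocal L (IsCMField.complexConj L) v) (cmLocalForm L 3 v)) ⧸ T) := ⟨BorelSpace.measurable_eq (α := Gqs L v ⧸ T)⟩
  -- every instance passed by position (no synthesis across the two spellings of the carrier)
  exact @tubeJacobianLocal_cartan_of_cmTorus L _ _ _ v hmsU hbU hlcU hscU ht2U ν hHaarU hRinvU T hTM hTcl hmsQ hbQ Φ hΦ tm ‹_› ‹_› htm w hw DM D hDD hJacLoc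

end Summit.HodgeConjecture.HodgeConjecture.Cruxes.H413.F0P3cStCharTSWeylHypSocketAdapter

end
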